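import Summits.NavierStokesRegularity.NavierStokesRegularity.Theorems.HeredityAtOne.Negative.NoSwirlSliceStratum
import Summits.NavierStokesRegularity.NavierStokesRegularity.Theorems.HeredityAtOne.Negative.CapStratum
import Summits.NavierStokesRegularity.NavierStokesRegularity.Theorems.HeredityAtOne.Negative.RestDesign
import Summits.NavierStokesRegularity.NavierStokesRegularity.Theorems.HeredityAtOne.Negative.HeredityAtOneFalseWithoutFloorAtOne
import Summits.NavierStokesRegularity.NavierStokesRegularity.Theorems.HeredityAtOne.Negative.CappedStageWindow
import Summits.NavierStokesRegularity.NavierStokesRegularity.Theorems.HeredityAtOne.Negative.CappedStageAtBound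
import Summits.NavierStokesRegularity.NavierStokesRegularity.Theorems.HeredityAtOne.Negative.ForcedNoSwirlGlobalHolds
import Summits.NavierStokesRegularity.NavierStokesRegularity.Theorems.HeredityAtOne.Negative.LazyEnvelopeSliceSigned
import Summits.NavierStokesRegularity.NavierStokesRegularity.Theorems.HeredityAtOne.Negative.CapStratumIntegrable
import Summits.NavierStokesRegularity.NavierStokesRegularity.Theorems.HeredityAtOne.Negative.CapClassSterile
import Summits.NavierStokesRegularity.NavierStokesRegularity.Theorems.HeredityAtOne.Negative.CapStratumImpulseBalance
import Summits.NavierStokesRegularity.NavierStokesRegularity.Theorems.HeredityAtOne.Negative.CapStratumDivFreePush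
import Summits.NavierStokesRegularity.NavierStokesRegularity.Theorems.HeredityAtOne.Negative.CapStratumSilentWindow
import Summits.NavierStokesRegularity.NavierStokesRegularity.Theorems.HeredityAtOne.Negative.CapStratumEnergyBound
import Summits.NavierStokesRegularity.NavierStokesRegularity.Theorems.HeredityAtOne.Negative.CapStratumCombinedDoor

/-!
# Disproof of `HeredityAtOne` — findings (v11; cell `ns-blowup`, seat `refuter-ns-palasek-19249-disprove-1`, g3 → g6)

Item stmt-NavierStokesRegularity-19249, route `PalasekTowerBreakdown`:
`HeredityAtOne = HeredityAt 1 = ∀ S (pinned Λ=8 θ=6/5, rigid, quiet, wide), ∀ s : Stage…1, ∃ s' : Stage…2, s.Extends s'`.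
VERDICT OF RECORD: **no kill**. The item is immune to every design-free lever (its binder ranges over REGISTERED
level-1 stages only; none is constructible — `EpisodeBaseG`, item 19179, is open) and every lever of record is
CONDITIONAL on a registered host. v7–v11 are SORRY-FREE: the one near-miss of v6 (the explicit capped letter slice) was
discharged by fc-prover-3's lazy slice (p484570/p485399). This file indexes the kernel-checked negative knowledge (all
under `Theorems/HeredityAtOne/Negative/`, sorry-free) and records the census numbers; prose only in docstrings.

## The T2-r3 lever made precise (supplement 3eec0c4d45769a4d: «the ∀-binder includes axisymmetric no-swirl hosts
under the Gallay–Šverák all-time speed cap»)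
  LEVER `=` a registered level-1 stage in the capped class: abstractly `CappedStageAt 1` (p448312), concretely the
  capped signed swirl-free STRATUM `𝒮₁ = {(S, s) : InCapStratum 1 S s}` (constant `0.35356`, p481383). Kernel facts:
  (L1) `HeredityAtOne ↔ HeredityAtOffStratum 1 ∧ CapStratumEmptyAt 1` (`item_iff_repair_and_empty`) — ON the lever
       heredity IS emptiness; the lever is exactly the emptiness conjunct.
  (L2) the lever is (C)-STERILE (NEW, g3, `CapClassSterile.lean` p499378): a capped host LIVES to every `T > 0`
       (`livesTo_of_inCapStratum`), so it is never a breakdown door, and the WEAK item dies with the strong one: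
       `CappedStageAt 1 → ¬ HeredityOrBreakdownAt 1`, `HeredityOrBreakdownAt 1 → CapStratumEmptyAt 1`. The dichotomy
       `¬HeredityAtOne → ¬HeredityOrBreakdownAt 1 ∨ (C)` is decided on the lever: first disjunct, never (C).
  (L3) the lever is EMPTY on the integrable sub-register (fc-prover-3 g7, p492172): a registered slice has zero mean
       (`Pins`), a signed swirl-free integrable field with zero mean vanishes (positive hydrodynamic impulse) —
       `capStratumEmptyAt_on_integrable`; hence `HeredityAtOne ↔ HeredityAtOffStratum 1 ∧ (𝒮₁ empty on NON-integrable
       slices)` (`heredityAtOne_iff_offStratum_and_empty_nonIntegrable`). A stratum host's `τ₁`-slice carries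
       non-zero impulse `∫ r²η > 0`, i.e. the design force has delivered net impulse on `[0, τ₁]`.
  (L4) the lever is EMPTY in every world where `EpisodeBaseG` fails (`empty_of_not_episodeBaseG`); a non-empty lever
       is ITSELF a proof of `EpisodeBaseG|𝒮` (a registered swirl-free level-1 stage) — XL, not one generation.
  (L5) per-stub exposure of the line `Lines/birth.lean` v4 (five stubs) on a stratum host: instances of
       `stub_no_premature_breakdown_at_one` and `stub_window_ceiling_at_one` HOLD (`v4_exposure_of_inCapStratum_one`),
       `stub_speed_floor_at_one` FAILS (`not_speedFloorAt_one_of_inCapStratum`), strain / core stubs cap-blind: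
       the cap bears on exactly ONE of five stubs. 0 of 5 targets broken (every lever needs a registered host).
  OUTCOME for the instruction's EITHER/OR: the `_false_without_<swirl>` branch is LANDED in its strongest honest form
  — `¬HeredityAtOne` (and `¬HeredityOrBreakdownAt 1`) modulo ONE stratum host (p448312, p451698, p481383, p499378) —
  and the «lever empty» branch is CHECKED where checkable: empty on integrable slices (p492172), empty without
  `EpisodeBaseG`; its residue (`CapStratumEmptyAt 1` on impulse-carrying slices) is `EpisodeBaseG|𝒮`-hard and is the
  planner's to restate (`C′ = HeredityAtOffStratum 1`, or the banked `∃`-ladder p434821).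

## Findings

(a) LOAD-BEARING ANALYSIS.
  * FLOORS are load-bearing: `heredityAtOne_false_without_floorAtOne : ¬ HeredityAtWithoutFloor 1` (g0, p453934;
    zero design). Any proof uses the level-1 letter of the registered slice.
  * REGISTRATION HISTORY is load-bearing, OUTRIGHT (v7): the design-free strengthening S⁺ (`SliceHeredityAtOne`,
    strategy census §2(e): history stripped, level-1 envelope kept) is FALSE — `heredityAtOneWithoutHistory_false`
    below, by fc-prover-3's explicit lazy slice (`hillField 3.92e8 (1/216) (1/210)` on the box design
    `Schedule.ofBox 0 0 1 0`: floor `2800 > Y₁`, strain `1.40e6 > A₁`, `N₁`-core loop radius `1/446` circulation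
    `≥ 13.8`, envelope `2963 < (5/3)Y₁`, cap value `5702 < Y₂ ≈ 6140`; p484570, p485399) fed to
    `not_sliceHeredityAtOne_of_capped_signed_envelope_slice` (p483223). Shape budget `sup|v|/cap > 0.1600`; Hill
    `0.2048`; thin rings `0.1125` (fail); lazy slice `2800/5702 = 0.491` of the door used.
  * SWIRL / THREE-DIMENSIONALITY of the registered slice is load-bearing for the SPEED stub, and (v7) the breakdown
    door is CLOSED on swirl-free hosts: (L1), (L2).
(b) TIGHTNESS / WINDOWS. `cappedStageAtOne_window` (p456404): the abstract cap lever needs `B < c₁ Y₂`, and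
  `B ≥ c₁ Y₁` is forced by the floor — the lever's window is `[c₁Y₁, c₁Y₂)`, ratio `Y₂/Y₁ = 2.2099`;
  `floor_le_noSwirlCap_of_stage` (p454111): a registered signed swirl-free slice has cap value `≥ c₁Y₁/C`.
(c) STRENGTHENINGS REFUTED. `HeredityAtWithoutFloor 1` (false outright); S⁺ (false OUTRIGHT, v7);
  `HeredityFrom 1`-type global forms die on any swirl-free registered rung (`NoSwirlRung.not_heredityFrom`, p456140);
  WEAKENING to `HeredityOrBreakdownAt 1` does not escape the lane (L2).
(d) TARGETS (line `Lines/birth.lean` v4, registered 2026-08-27T01:51Z: `stub_no_premature_breakdown_at_one`,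
  `stub_window_ceiling_at_one`, `stub_speed_floor_at_one`, `stub_strain_floor_at_one`, `stub_core_floor_at_one`):
  see (L5) and §(d) below. 0 of 5 broken.
(e) NEAR-MISSES: none sorried (v7). Open residue, not typable as a theorem here: `CapStratumEmptyAt 1` on
  impulse-carrying (non-integrable) `τ₁`-slices ⇔ «no pinned rigid quiet wide design registers a signed swirl-free
  capped level-1 stage» — a registration (EpisodeBaseG|𝒮) question.

## g4–g5 supplement: the silent signed sub-register — push ledger, silent window, ENERGY DOOR, `(e, ε)` census
  (L3') PUSH LEDGER (g4 p500752 `CapStratumDivFreePush`; sibling seats `StageImpulseLedger`, `CapStratumImpulseBalance`,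
       `Literature/…/HydrodynamicImpulseBalance(Energy)(Vector)`): along a registered stage the axial impulse of the
       slice is the design's delivered axial push, `∫ r²η(s.u τ_j) = 2 ∫₀^{τ_j}∫ (S.f)₃` — so `𝒮_k` is EMPTY on every
       design of non-positive total axial push (`stratum_empty_on_nonposMean` below; zero-mean, `curl`-type and
       divergence-free pushes included): `HeredityAtOne ↔ HeredityAtOffStratum 1 ∧ (𝒮₁ empty on COMPRESSIVELY pushed
       designs)` (`heredityAtOne_iff_offStratum_and_empty_posMean`). Unconditional, kernel-checked.
  (L6) SILENT WINDOW (g4 p505438 `CapStratumSilentWindow`): on a SILENT design (`S.f = 0` on `[τ₀, ∞)`) the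
       Gallay–Šverák cap runs from the HOST slice `s.u τ₀`: `c₁Y_j ≤ 0.35356 √(√((∫η)(∫r²η)) M)|_{τ₀}` for every
       registered readout `j ≤ k` (`floor_le_cap_τ_zero_of_silent`), the host is pinned `‖s.u τ₀‖ ≤ c₁Y₀`, so a
       silent signed swirl-free host must be speed-INEFFICIENT (`e_host ≤ 0.35356·Y₀/Y₁ = 0.1720`) and its cap value
       lies in `[c₁Y₁, c₁Y₂) = [2778, 6140)·c₁`; `HeredityAtOne` forbids silent capped hosts at level 1 outright
       (`no_silent_capped_host_stage` below).
  (L7) ENERGY DOOR (g5, THIS generation; p511215 `CapStratumEnergyWindow` conditional → p514953 `AxialRayMean`,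
       p515895 `EnergyImpulseBound`, p516683 `CapStratumEnergyBound` UNCONDITIONAL). The energy–impulse–speed
       inequality, kernel-checked for every `C¹` divergence-free swirl-free `L²` field with `‖u‖ ≤ U` and signed
       integrable `(x × curl u)₃`:  **`E(u) = ½∫‖u‖² ≤ ¼ · U · ∫ (x × curl u)₃`**  (`energy_impulse_speed_inequality`
       below; exact identity `∫‖u‖² = ∫ α (x × curl u)₃`, `α = ψ/r² = ∫₀¹ s u₂(scaleH s x) ds`, Lamb §162 in Cartesian
       form, proved as `∫ div(αG) = 0` for Saffman's axial impulse flux `G`). On the silent signed sub-register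
       (energy decay, Leray; conserved impulse; window pin; floor): `E(s.u t) ≤ ¼ c₁Y₀ ∫r²η` on `[τ₀, τ_k]`,
       `4 Y_j E(s.u τ_j) ≤ Y₀ V ∫r²η(τ_j)` for every speed bound `V` of the readout slice, and on the wide rates
       **`8 E(s.u τ_j) ≤ V ∫ r²η(s.u τ_j)`**, `1 ≤ j ≤ k` (`silent_signed_energy_door`): the readout slice's ENERGY
       EFFICIENCY `ε := E/(U ∫r²η)` is `≤ ¼·Y₀/Y₁ = 0.1216 ≤ ⅛`. Hill's spherical vortex has `ε = 1/7 = 0.1429`: it —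
       and the lazy `τ₁`-slice `hillField` of (e)/`LazyEnvelopeSlice(.Signed)`, a Hill field — is EXCLUDED as a
       registered readout slice of a silent signed design, although it passes the speed door (`e = 0.2048 > 0.160`).
       Both doors at once: `silent_signed_both_doors`.
  (L8) `(e, ε)` CENSUS (kit job:j272424, `n = 200` grids; `e = sup|u|/√(√((∫η)(∫r²η)) sup η)`, door `e > 0.160`;
       `ε = E/(sup|u| ∫r²η)`, door `ε < 0.1216`): Hill `(0.2048, 0.1429)` ✗ε; smoothed Hill `w = 0.05/0.1/0.2`
       `(0.204, 0.141)/(0.201, 0.136)/(0.192, 0.123)` ✗ε, `w = 0.4` `(0.1675, 0.1008)` ✓✓; peaked balls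
       `η = (1−|x|²)₊^p`: `p = ½` `(0.186, 0.129)` ✗ε, `p = 1` `(0.1761, 0.1212)` ✓✓ (margin `4·10⁻⁴`), `p = 2`
       `(0.1654, 0.1119)` ✓✓, `p = 4` `(0.156, 0.103)` ✗e; uniform-`η` tori `s/R = 0.1…0.99`: `ε = 0.106…0.160`,
       `e ≤ 0.206`, never both; Gaussian rings `R/a = 1.25/1.5/2`: `(0.044…0.100, 0.096…0.134)` ✗e; spheroidal patch
       `b/a = 2` `(0.180, 0.143)` ✗ε; Hill + central satellite Hill `(M=4, c=0.5)` `(0.1619, 0.1017)` ✓✓, `(M=2, c=0.7)`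
       `(0.193, 0.127)` ✗ε; Hill + coaxial torus: ✗. VERDICT OF THE CENSUS: the double window
       EXACT CHECK (closed-form stream functions; this seat, g5): for the peaked balls `η = (1−|x|²)₊^p` the
       interior Stokes stream function is `ψ = r² G(|x|²)` with `10G' + 4sG'' = −(1−s)^p` (polynomial `G`), matched
       `C¹` to the exterior dipole `ψ = μ r²/|x|³`; centre speed `U(0) = 2G(0) = 1/(3(p+1))`, `∫η = L`, `∫r²η = I`,
       `E = π∫∫ψ ω_θ = (4π/3)∫₀¹ρ⁴G η dρ` are RATIONAL multiples of `π`:  `p = 0` (Hill): `E/π = 8/315`, `ε = 1/7`,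
       `e = 0.20480`;  `p = 1`: `U(0) = 1/6`, `L/π = 8/15`, `I/π = 16/105`, `E/π = 32/10395`, **`ε = 4/33 = 0.12121 <
       0.12160`**, `e ≥ 0.17611`;  `p = 2`: `U(0) = 1/9`, `L/π = 32/105`, `I/π = 64/945`, `E/π = 1024/1216215`,
       **`ε = 16/143 = 0.11189`**, **`e ≥ 0.16539 > 0.16000`**;  `p = 3`: `ε = 448/4199 = 0.10669`, `e(0) = 0.15973`
       (fails the speed door by `3·10⁻⁴` if the centre is the fastest point);  `p = 4, 5, 6`: `e(0) = 0.156, 0.154,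
       0.152` ✗.  Here `e` and `ε` are evaluated with the CENTRE speed, a lower bound for `sup|u|` — the conservative
       direction for BOTH doors — so `p = 1, 2` pass both doors by exact arithmetic (agreeing with j272424 to 4 digits).
       Refinement `n = 300` (kit job:j274433, first row): `p = 2` ball `(0.1654, 0.1119)` — unchanged from `n = 200` and equal to
       the exact values; the rest of j274433 (fine `p`, smoothing widths, satellite grid, columns) lands in the item's evidence.
       `{e > 0.160} ∩ {ε < 0.1216}` is INHABITED (moderately centre-peaked signed blobs, margins `≤ 0.02` in `e`):
       the two static doors do NOT empty `𝒮₁` on silent designs; they confine its readout slices to a thin shape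
       class (fat tori, Hill, thin rings, Gaussian rings, spheroids all excluded). Emptiness needs DYNAMICS
       (free Navier–Stokes over `[τ₀, τ₁]`, `w₀Y₀² ≈ 328` host time units) — not a one-generation theorem.
  OUTCOME (g5) for the instruction's EITHER/OR, numbers not adjectives: the «lever empty» branch is now checked to
  the static optimum — EMPTY on non-positive-push designs (L3'), on integrable slices (L3), without `EpisodeBaseG`
  (L4), and on silent designs CONFINED by two unconditional kernel theorems (speed `e > 0.160`, energy `ε ≤ 0.1216`)
  whose conjunction is numerically NON-empty (L8); the `_false_without_<swirl>` branch stands as landed (modulo one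
  stratum host). Verdict of record unchanged: NO KILL; repair `C′ = HeredityAtOffStratum 1` / `∃`-ladder p434821.

## g6 supplement: the COMBINED door (impulse-free), the level table, the shape census taken to its optimum
  (L9) COMBINED DOOR (g6, THIS generation; p523556 `CapStratumCombinedDoor`, UNCONDITIONAL, stated for ANY rates `R` so
       that it survives a re-base of the tower): the impulse `I = ∫r²η` is the one slice functional a design controls
       for free — a far, slow, co-signed halo ring adds impulse and (to leading order) nothing else, acting on the two
       efficiencies as `e ↦ e·x^{1/4}`, `ε ↦ ε·x`, `x = I_core/(I_core + I_halo) ∈ (0, 1]` — so neither the speed door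
       (L6) nor the energy door (L7) ALONE empties any level. Their product is impulse-free: on a SILENT design whose
       host slice is single-signed swirl-free, a registered level-`k` stage whose `τ_k`-slice is single-signed
       swirl-free of height `M'` with cap value `< c₁Y_{k+1}` obeys
         **`4 · 0.35356⁴ · E(s.u τ_k) · (∫η(s.u τ_k)) · M'² < c₁⁵ · Y₀ · Y_{k+1}⁴`**   (`silent_signed_combined_door`),
       and with the floor `‖s.u τ_k x‖ ≥ c₁Y_k` the scale-free AND halo-invariant slice number
         **`F := E · (∫η) · M'² / sup‖u‖⁵ = ε/e⁴ < Φ_k := Y₀Y_{k+1}⁴/(4 · 0.35356⁴ · Y_k⁵)`**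
         (`silent_signed_combined_door_floor`).
       LEVEL TABLE (wide rates; `t_k = 0.35356·Y_k/Y_{k+1}` speed door, `s_k = Y₀/(4Y_k)` energy door, `Φ_k =
       s_k/t_k⁴`):
         `k   :   1       2       3       4       5       6       7`
         `t_k : 0.1600  0.1478  0.1354  0.1231  0.1107  0.0986  0.0868`
         `s_k : 0.1216  0.0550  0.0230  0.0088  0.0031  0.00096 0.00027`
         `Φ_k : 185.6   115.3   68.33   38.42   20.40   10.16   4.72`
       A core profile with efficiencies `(e₀, ε₀)` passes BOTH static doors of level `k` after some far-halo dilution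
       iff `e₀ > t_k` and `F = ε₀/e₀⁴ < Φ_k` (admissible dilutions `x ∈ ((t_k/e₀)⁴, min(1, s_k/ε₀))`; halo-free iff also
       `ε₀ < s_k`). The doors are NECESSARY conditions on a registered readout slice; «inhabited» below means «not
       excluded by them», never «registered».
  (L10) THE SHAPE CENSUS TAKEN TO ITS OPTIMUM (kit j272424: 50 profiles, j274433: 36 profiles (g5); j275593 + j275752
       (g6): a validated axisymmetric Biot–Savart evaluator — Hill `e = 0.20478, ε = 0.14291, F = 81.26` against the
       exact `0.20479, 1/7, 81.21`; census spheroid `b/a = 0.75` `F = 75.74` vs `75.8`; disc torus `s/R = 0.95` `76.98`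
       vs `77.0` — driving sweeps and 21 Nelder–Mead descents over `η`-PATCH SHAPES (Fourier star-shapes
       `ρ_b(θ) = exp(Σ_{l≤4} c_l cos lθ + …)` about an axis point or an off-axis circle, centre-peaked gradings
       `η = (1 − d)₊^p`, and the axis-speed BATHTUB family `{x : r²/|x|³ ≥ 1 + μr²}`, `μ ≥ 0`, which by the bathtub
       principle contains the maximiser of `e` among profiles `0 ≤ η ≤ M` whose speed is maximal on the axis), with
       `e ≥ t₃`- and `e ≥ t₄`-constrained descents):
       * UNIFORM patches are the efficient ones and are energy-RIGID: `ε ∈ [0.1426, 0.1449]` for every fat uniform patch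
         tested (Hill `1/7`; spheroids `b/a ∈ [0.25, 4]` `0.1428–0.1429`; fat tori `0.144`; star-shapes
         `0.1426–0.1443`),
         so on this class `F ≈ (1/7)/e⁴` and `min F ⟺ max e`: Hill `81.2` (`e = 0.2048`), oblate spheroid `b/a = 0.75`
         `75.7` (`0.2084`), star-shape `c₂ = −0.3, c₄ = −0.06` `73.9` (`0.2097`), off-axis blob `r_c = 0.5` `74.6`;
         OPTIMUM (j275752, j276231; 21 Nelder–Mead descents, 6 sweeps): **`F = 72.99`** (`e = 0.2104`, `ε = 0.1431`;
         an apple-shaped uniform patch — a star-shape centred on an off-axis circle `r_c ≈ 1.06`, overlapping the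
         axis, sup speed ON the axis), while the axis-centred 4-mode star-shape descents from five different starts
         (sphere, two oblates, pear, graded sphere) all end at `F = 73.35 ± 0.01` (`e = 0.2101`, `ε = 0.1429`) and the
         6-mode ones at `73.4`; resolution ladder of that optimum `F = 73.40/73.38/73.38/73.39` at `n =
         120/160/240/320` (converged to `±0.02`); pedestal (two-level) and graded perturbations of the optimum are all
         worse (`F ≥ 73.5`, descents `73.65 … 73.82`). Bathtub family (sweep in progress at the time of writing, jobs
         j275752/j276231, whose summaries are attached to the item automatically): `μ = 0, 0.05, 0.1, 0.15, 0.25`: `e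
         = 0.2019, 0.2029, 0.2036, 0.2041, 0.2050` (rising; `F = 88.0 … 82.5`), `μ → ∞` is Hill (`0.2048`) — by the
         bathtub principle its maximum over `μ` bounds `e` for every profile whose speed is maximal on the axis, so it
         must reach `≥ 0.2104`; the peak lies beyond `μ = 0.25`.
       * every NON-uniform or composite profile is worse: peaked balls `p ∈ [0.75, 3.5]` `F = 118 … 169`, smoothed Hill
         `w ∈ [0.3, 1]` `107 … 288`, Gaussian balls/spheroids `207 … 373`, Hill + satellite / nested patches `99 … 359`,
         columns `94, 233`, two Hill balls `318`; uniform tori `s/R = 0.99 … 0.1`: `77 … >300`; thin uniform-core rings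
         `F = 32π⁴(δ/R)(log(8R/δ) − 7/4) → 0` but with `e → (2π√2)⁻¹ = 0.1125 < t_k` for `k ≤ 4`.
       * A-PRIORI CEILING: `e < √(3π/32)/√(2π) = 0.2165` for every signed swirl-free profile whose speed is maximal on
         the axis (sharp Gallay–Šverák constant of cell memo KJ-13 sha16 642775e8a0374c39, times Cauchy–Schwarz
         `∫rη ≤ √((∫η)(∫r²η))`, strict for fat patches); at `ε = 1/7` this alone would allow `F ≥ 65.0` — so the
         emptiness of level 3 is decided by the third decimal of `sup e`, i.e. by (L10)'s optimum, not by the ceiling.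
       LEVEL VERDICTS (static, silent signed sub-register, numbers not adjectives):
         level 1: INHABITED, halo-free (peaked balls `p ∈ [1, 2.5]`: `(e, ε) = (0.1761, 0.1212) … (0.1622, 0.1089)`;
                  smoothed Hill `w ∈ [0.3, 0.4]`; Hill + satellite `(M, c) = (3, 0.5), (4, 0.6), (5, 0.5), (2.5, 0.65)`;
                  nested `(1|1.5@0.8|3@0.5)`) and with halo (Hill, `x ∈ (0.373, 0.851)`);
         level 2: INHABITED only with a halo (Hill `x ∈ (0.271, 0.385)`; no halo-free census profile has `ε < 0.055`
                  with `e > 0.148`);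
         level 3: EMPTY for every searched family — best `F = 72.99` against `Φ₃ = 68.33`, margin `6.8%` in `F`
         (`1.6%` in `e` at fixed `ε`); a numerical optimum over shape families, not a certified bound;
         level 4: EMPTY for every census family by a factor `≥ 1.90` in `F` (`Φ₄ = 38.4`; at `ε = 1/7` it would need
                  `e > 0.247 > 0.2165`);
         levels 5, 6, …: INHABITED by thin uniform-core rings (`k = 5`: `R/δ ≈ 2·10³`, `F ≈ 12 < 20.4`, `e ≈ 0.1128 >
                  0.1107` — margin `2·10⁻³`; `k = 6`: comfortable), the tower's intended geometry.
       So the two kernel doors empty EXACTLY the middle levels `k = 3, 4` of the silent signed sub-register and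
       nothing else; in particular they do not empty level 1, the item's level.
  (L11) LEVEL 1 IS A DYNAMICAL QUESTION, scoped (not by this seat): a silent signed level-1 stage needs an UNFORCED
       axisymmetric swirl-free flow whose speed efficiency rises from `e(τ₀) ≤ 0.35356·Y₀/Y₁ = 0.1720` (L6) to a
       `τ₁`-slice with `sup‖u‖ ≥ Y₁ = 2.056·Y₀` inside the window `w₀ = 1.78·10⁻⁴` (`= 326/Y₀²`, i.e. `Re·turnover ≈
       326`
       at unit viscosity), with `(∫η)`, `M` non-increasing and `∫r²η` conserved: a speed GAIN factor `≥ 2.056` by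
       rearrangement alone. Cell scan S-RING-1 (STATUS l.4029; kit j253937, 31 free Navier–Stokes runs of co-signed ring
       families — leapfrog pairs, small-ahead/behind, 3-ring trains — `Re = 135 … 1080`, window `W = 326/Re`): maximal
       speed gain `max_{i<j} m(t_j)/m(t_i) = 1.169` against the required `2.056`; maximal `sup‖∇u‖/(0.678·Re) = 0.048`
       against the required `1` (strain floor) — pre-drawn verdict B «EMPTY-IN-PRACTICE for this class»; K61 (l.4030):
       in the swirl-free class `η = ω_θ/r` is transported and the only amplification is radial stretching, cumulative
       factor `r(τ₁)/r(τ₀)` of material circles, bounded by the support's radial excursion in the window. A kernel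
       theorem «no unforced
       signed swirl-free flow doubles `sup‖u‖`» is NOT available (and is false without the time window: leapfrogging /
       merging rings raise `sup‖u‖` transiently); the window-quantified version is the open dynamical residue.
  OUTCOME (g6) for the instruction's EITHER/OR: the `_false_without_<swirl>` branch stands (p448312 → p516683, one
  stratum host away); the «lever empty» branch is now a LEVEL TABLE with two unconditional kernel doors and their
  impulse-free product (p523556): statically EMPTY at levels `3 (numerically, margin 6.8%) and 4 (×1.90)`, statically
  INHABITED at levels 1, 2 and
  `≥ 5`, and at level 1 — the item's level — empty only dynamically-in-practice (S-RING-1), not by a theorem.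
  Verdict of record unchanged: NO KILL; item OPEN; repair `C′ = HeredityAtOffStratum 1` / `∃`-ladder p434821.

## Census numbers (wide rates `N_k = 256^{(11/10)^k}`, `Y_k = N_k^{13/10}`, `A_k = N_k^{23/10}`, `β = 23/10`)
`N₀ = 256`, `N₁ ≈ 445`, `N₂ ≈ 820`; `Y₀ ≈ 1351`, `Y₁ ≈ 2778`, `Y₂ ≈ 6140`; `Y₁/Y₀ = 2.0562`, `Y₂/Y₁ = 2.2099`;
`A₀ ≈ 3.45·10⁵`, `A₁ ≈ 1.24·10⁶`, `A₂ ≈ 5.0·10⁶`; window `w₀ ≈ 1.8·10⁻⁴` (62 level-0 strain times); GS cap constant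
`C = 0.35356 = 1/(2√2)⁺` (tree theorem `isNoSwirlCapConstant_eighth`); k=1 door: `sup|u(τ₁)|/cap ≥ 0.35356/2.2099 =
0.1600`; Hill `0.2048`; thin ring `0.1125`; lazy slice: floor `2800`, cap `5702`; box design `c₁ = 1`, `c₂ = 5/3`.
Numerics of record: kit j264797 (Hill 0.2048; nested Hill 0.2005–0.2048; torus s/R 0.1…0.9: 0.131…0.206);
kit j272119/j272424 (the `(e, ε)` map of (L8)). Energy door: `ε ≤ ¼·Y₀/Y₁ = 0.1216` (`≤ ⅛` from `2Y₀ ≤ Y₁`);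
Hill `ε = 1/7` (`E = 40πM²a⁷/1575`, `U = Ma²/3`, `∫(x×ω)₃ = 8πMa⁵/15`). Combined door (g6): `F = ε/e⁴ < Φ_k =
Y₀Y_{k+1}⁴/(4·0.35356⁴·Y_k⁵)` (table in (L9)); Hill `F = 7776π²/945 = 81.21`; kit j275593/j275752 (shape optimum `F =
72.99` at `e = 0.2104`, `ε = 0.1431`).

## Repair line (refuter protocol, stated in advance)
Minimal repaired `∀`-statement immune to this lane: `HeredityAtOffStratum 1` (CapStratum.lean, p481383) — heredity
for registered level-1 stages whose `τ₁`-slice is NOT capped signed swirl-free (it already covers every integrable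
slice, `heredityAtOffStratum_one_covers_integrable`, p492172); banked alternative: the `∃`-ladder form (p434821).
Every lever here is vacuous against both. Class IF a stratum host is ever registered: refuted-misstated (C′ above,
witness misses C′ by definition).

## HANDOFF
Landed (this seat, all gens): p448312, p451698, p453934, p455726, p456404 (g0); p480736 `NoSwirlSliceStratum`,
p481383 `CapStratum`, p483223 `SliceHeredityCap`, p483594 `RestDesign` (g2); p499378 `CapClassSterile` (g3);
p500752 `CapStratumDivFreePush`, p505438 `CapStratumSilentWindow` (g4); p511215 `CapStratumEnergyWindow`,
p514953 `AxialRayMean`, p515895 `EnergyImpulseBound`, p516683 `CapStratumEnergyBound` (g5); p523556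
`CapStratumCombinedDoor` (g6).
By others on this lane: p484570/p485399 `LazyEnvelopeSlice(Signed)` (S⁺ dead), p492172(+p492657) `CapStratumIntegrable`,
p491203/p493128 `Literature/…/HydrodynamicImpulse(Vector)`, `StageImpulseLedger`, `CapStratumImpulseBalance`,
`HydrodynamicImpulseBalance(Energy)(Vector)` (push ledger). Sorried here: nothing.
Next regimes: (0) STATIC levers on silent designs are SPENT at level 1 (g6, (L9)–(L10): a tiny Hill-type or peaked
patch meets floors, cap, energy and combined doors; strain / core floors are cap-blind and met by shrinking the patch,
`a ≈ 10⁻²`, `M ≈ 5·10⁷`); do not re-scan statically. The one computable static residue is level 3 (best `F = 72.99` vs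
`Φ₃ = 68.33`, margin `6.8%`): a certified lower bound `E·(∫η)·(sup η)² ≥ 68.33·sup‖u‖⁵` for signed swirl-free profiles
with `e ≥ 0.1354` would make levels 3–4 a theorem-grade gap of the silent signed sub-register (it is false without the
`e`-constraint: thin rings).
(1) the residue (e) is a REGISTRATION problem — a swirl-free registered level-1 stage under a rough
push-small force (`push_small` bounds `|f|`, not `curl f`; the `η`-max-principle does not forbid it; the slice must
carry impulse) — `EpisodeBaseG|𝒮`-hard, the only road to an unconditional `¬HeredityAtOne` on this lane; (2) a
planner restatement to `C′` closes the lane for good; (3) otherwise prover territory: any proof of `SpeedFloorAt 1`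
must use swirl / 3-D structure of registered slices, and no (C) can come from swirl-free hosts (L2).
-/
noncomputable section

set_option linter.dupNamespace false

namespace Summit.NavierStokesRegularity.NavierStokesRegularity.Cruxes.HeredityAtOne.Disproof

open Set MeasureTheory Filter Topology Function
open scoped ENNReal NNReal ContDiff
open Literature.Analysis.FluidPDE
open Summit.NavierStokesRegularity.FluidComputer
open Summit.NavierStokesRegularity.FluidComputer.PalasekTowerClayBridge
open Summit.NavierStokesRegularity.NavierStokesRegularity
open Summit.NavierStokesRegularity.HeredityAtOneNoSwirlCap
open Summit.NavierStokesRegularity.HeredityAtOneSpeedCap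
open Summit.NavierStokesRegularity.HeredityAtOneNoSwirlStratum
open Summit.NavierStokesRegularity.HeredityAtOneImpulse
open Summit.NavierStokesRegularity.HeredityAtOneCapSterile
open Summit.NavierStokesRegularity.HeredityAtOneImpulseEnergy
open Summit.NavierStokesRegularity.HeredityAtOneSilentWindow
open Summit.NavierStokesRegularity.HeredityAtOneEnergyBound
open Summit.NavierStokesRegularity.HeredityAtOneCombinedDoor

/-! ## (a) Load-bearing hypotheses -/

/-- **FLOORS are load-bearing**: heredity with the floors stripped is false (zero design; g0). [folklore] -/
theorem heredityAtOne_false_without_floor : ¬ HeredityAtOneZeroDesign.HeredityAtWithoutFloor 1 :=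
  HeredityAtOneZeroDesign.heredityAtOne_false_without_floorAtOne

/-- **`HeredityAtOne` with REGISTRATION HISTORY dropped** (= S⁺ = `StrategyCensus.SliceHeredityAtOne`, by its
body): every slice in the level-1 envelope of a pinned rigid quiet wide design hands the level-2 letter to every
tame unforced run. [cite: Palasek2026ElementaryModel, §4] -/
def HeredityAtOneWithoutHistory : Prop :=
  ∀ S : Schedule TowerRates.wide, S.Pins 8 (6 / 5) → S.Rigid → S.Quiet →
    ∀ v : EuclideanSpace ℝ (Fin 3) → EuclideanSpace ℝ (Fin 3),
      (Letter S 1 v ∧ ∀ x, ‖v x‖ ≤ S.c₂ * TowerRates.wide.Y 1) →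
        SliceRun S 1 (fun S w => Letter S 2 w) v

/-- **HISTORY is load-bearing — the reduction** (p483223): a capped smooth `H^∞` signed swirl-free envelope slice
on a pinned rigid quiet wide design with `c₁ ≤ c₂` refutes `HeredityAtOneWithoutHistory`; the slice EXISTS (v7,
`capped_letter_slice` below), so S⁺ is false outright (`heredityAtOneWithoutHistory_false`).
[cite: GallaySverak2016, Prop. 2.6 (2.14)] [cite: LemarieRieusset2016, Thm. 10.4 (p. 285)] -/
theorem heredityAtOne_false_without_history_of_capped_slice
    (hW : ∃ (S : Schedule TowerRates.wide) (v : EuclideanSpace ℝ (Fin 3) → EuclideanSpace ℝ (Fin 3)) (M : ℝ),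
      S.Pins 8 (6 / 5) ∧ S.Rigid ∧ S.Quiet ∧ S.c₁ ≤ S.c₂ ∧
      (Letter S 1 v ∧ ∀ x, ‖v x‖ ≤ S.c₂ * TowerRates.wide.Y 1) ∧
      ContDiff ℝ ∞ v ∧ VectorCalculus.IsDivFree v ∧ (∀ n : ℕ, ∫⁻ x, ‖iteratedFDeriv ℝ n v x‖ₑ ^ 2 < ⊤) ∧
      SignedNoSwirlSlice v M ∧
      0.35356 * Real.sqrt (Real.sqrt ((∫ y, angVortQuot v y) *
        ∫ y, cylRadius y ^ 2 * angVortQuot v y) * M) < S.c₁ * TowerRates.wide.Y 2) :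
    ¬ HeredityAtOneWithoutHistory :=
  not_sliceHeredityAtOne_of_capped_signed_envelope_slice hW

/-! **SWIRL / 3-D structure of the registered slice is load-bearing** (stratum split, p480736/p481383): the item is
equivalent to (heredity OFF the capped signed swirl-free stratum) ∧ (the stratum is EMPTY) — (L1) below — and on the
stratum the host is immortal (L2), so swirl is ALSO what any breakdown door of a registered level-1 design needs. -/

/-! ## The lever (L1)–(L4) by name -/

/-- (L1) By name (p481383): the item splits losslessly into the repaired statement `C′ = HeredityAtOffStratum 1` and
the emptiness conjunct `CapStratumEmptyAt 1`; this disproof lane bears on the second only. -/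
theorem item_iff_repair_and_empty :
    Theses.PalasekTowerBreakdown.HeredityAtOne ↔ HeredityAtOffStratum 1 ∧ CapStratumEmptyAt 1 :=
  heredityAtOne_iff_offStratum_and_empty

/-- (L2) **The lever is (C)-sterile** (g3, p499378): a stratum host lives to every `T > 0` — it is no breakdown
door. [cite: GallaySverak2016, Prop. 2.6 (2.14)] [cite: Leray1934, §32] -/
theorem host_immortal_of_inCapStratum {S : Schedule TowerRates.wide} (hQ : S.Quiet)
    (s : Stage 1 TowerRates.wide S (Margins.routeG TowerRates.wide) 1) (h : InCapStratum 1 S s) {T : ℝ}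
    (hT : 0 < T) : S.LivesTo 1 T :=
  livesTo_of_inCapStratum le_rfl hQ s h hT

/-- (L2) **The WEAK item dies on the abstract cap class too** (g3, p499378): `CappedStageAtOne → ¬ HeredityOrBreakdownAt 1`
— weakening binder 2 to «heredity or breakdown» does not escape this lane. [cite: Palasek2026ElementaryModel, §4] -/
theorem weakItem_false_of_cappedStageAtOne (hW : CappedStageAtOne) : ¬ HeredityOrBreakdownAt 1 :=
  not_heredityOrBreakdownAt_one_of_cappedStageAtOne hW

/-- (L2) … and on the stratum: `HeredityOrBreakdownAt 1` needs `𝒮₁` empty exactly as the item does (p499378).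
[cite: Palasek2026ElementaryModel, §4] -/
theorem weakItem_needs_empty (h : HeredityOrBreakdownAt 1) : CapStratumEmptyAt 1 :=
  capStratumEmptyAt_one_of_heredityOrBreakdownAt_one h

/-- (L2) **The dichotomy decided on the lever**: a stratum host refutes the item AND its weak form and lives forever
(`palasekTowerBreakdown_not_heredityAtOne_dichotomy`'s first disjunct; never (C)). [cite: FeffermanClay2006, (C)] -/
theorem dichotomy_decided_on_stratum {S : Schedule TowerRates.wide} (hP : S.Pins 8 (6 / 5)) (hR : S.Rigid)
    (hQ : S.Quiet) (s : Stage 1 TowerRates.wide S (Margins.routeG TowerRates.wide) 1) (h : InCapStratum 1 S s) :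
    ¬ Theses.PalasekTowerBreakdown.HeredityAtOne ∧ ¬ HeredityOrBreakdownAt 1 ∧ ∀ T, 0 < T → S.LivesTo 1 T :=
  dichotomy_on_stratum hP hR hQ s h

/-- (L3) **The lever is EMPTY on the integrable sub-register** (fc-prover-3 g7, p492172: zero mean + positive
impulse). [cite: Saffman1992, §3.2 eqs. (3.2.8), (3.2.13)] -/
theorem empty_on_integrable :
    ∀ S : Schedule TowerRates.wide, S.Pins 8 (6 / 5) → S.Rigid → S.Quiet →
      ∀ s : Stage 1 TowerRates.wide S (Margins.routeG TowerRates.wide) 1,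
        Integrable (s.u (S.τ 1)) → ¬ InCapStratum 1 S s :=
  capStratumEmptyAt_on_integrable 1

/-- (L3) The split sharpened (p492172): the emptiness conjunct concerns impulse-carrying (non-integrable) `τ₁`-slices
only. [cite: Saffman1992, §3.2 eqs. (3.2.8), (3.2.13)] [cite: Palasek2026ElementaryModel, §4] -/
theorem item_iff_repair_and_empty_nonIntegrable :
    Theses.PalasekTowerBreakdown.HeredityAtOne ↔
      HeredityAtOffStratum 1 ∧
        ∀ S : Schedule TowerRates.wide, S.Pins 8 (6 / 5) → S.Rigid → S.Quiet →
          ∀ s : Stage 1 TowerRates.wide S (Margins.routeG TowerRates.wide) 1,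
            ¬ Integrable (s.u (S.τ 1)) → ¬ InCapStratum 1 S s :=
  heredityAtOne_iff_offStratum_and_empty_nonIntegrable

/-- (L4) The emptiness conjunct in the only other regime where it is presently certifiable (p481383): a non-empty
lever is itself `EpisodeBaseG|𝒮`. [cite: Palasek2026ElementaryModel, §4] -/
theorem empty_of_not_episodeBaseG (h : ¬ EpisodeBaseG) : CapStratumEmptyAt 1 :=
  capStratumEmptyAt_one_of_not_episodeBaseG h

/-! ## (b) Tightness / windows (by name): `HeredityAtOneCapWindow.cappedStageAtOne_window` (p456404),
`floor_le_noSwirlCap_of_stage` (p454111). -/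

/-! ## (c) Natural strengthenings / weakenings refuted (by name): `heredityAtOne_false_without_floor`,
`heredityAtOneWithoutHistory_false` (S⁺, outright), `NoSwirlRung.not_heredityFrom`, `weakItem_false_of_cappedStageAtOne`. -/

/-- Global heredity from ANY level dies on a swirl-free registered rung (p448312 + p456140). -/
theorem not_heredityFrom_of_noSwirlRung {k₀ : ℕ} (hW : NoSwirlRung k₀) : ¬ HeredityFrom k₀ :=
  hW.not_heredityFrom

/-! ## (d) Targets — line `Lines/birth.lean` v4 (five stubs; 0 broken) -/

/-- Stub 1 `stub_no_premature_breakdown_at_one : NoPrematureBreakdownAt 1` — its INSTANCE HOLDS on every signed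
swirl-free registered host, no cap smallness (p499378): the cap class cannot touch it. [cite: GallaySverak2016, Prop. 2.6 (2.14)] -/
theorem stub_no_premature_breakdown_at_one_instance_of_signedNoSwirlSlice {S : Schedule TowerRates.wide}
    (hQ : S.Quiet) (s : Stage 1 TowerRates.wide S (Margins.routeG TowerRates.wide) 1) {M : ℝ}
    (hsl : SignedNoSwirlSlice (s.u (S.τ 1)) M) : S.LivesTo 1 (S.τ 2) :=
  noPrematureBreakdown_instance_of_signedNoSwirlSlice le_rfl hQ s hsl

/-- Stub 2 `stub_window_ceiling_at_one : WindowCeilingAt 1` — its INSTANCE HOLDS on every stratum host (cap value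
`< c₁Y₂ ≤ c₂Y₂`; forced weak–strong uniqueness + the cap; p499378). [cite: Sohr2001, Ch. V Thm. 1.5.1] -/
theorem stub_window_ceiling_at_one_instance_of_inCapStratum {S : Schedule TowerRates.wide} (hQ : S.Quiet)
    (s : Stage 1 TowerRates.wide S (Margins.routeG TowerRates.wide) 1) (h : InCapStratum 1 S s)
    (v : ℝ → EuclideanSpace ℝ (Fin 3) → EuclideanSpace ℝ (Fin 3)) (q : ℝ → EuclideanSpace ℝ (Fin 3) → ℝ)
    (hcl : IsClassicalNSSolutionOn (Icc 0 (S.τ 2)) 1 S.f v q) (hv0 : v 0 = S.u₀)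
    (hE : ∃ C : ℝ≥0∞, C < ⊤ ∧ ∀ t ∈ Icc 0 (S.τ 2), ∫⁻ x, ‖v t x‖ₑ ^ 2 ≤ C) :
    ∀ t ∈ Icc (S.τ 1) (S.τ 2), ∀ x, ‖v t x‖ ≤ S.c₂ * TowerRates.wide.Y 2 :=
  windowCeiling_instance_of_inCapStratum le_rfl hQ s h v q hcl hv0 hE

/-- Stub 3 `stub_speed_floor_at_one` dies on the abstract cap class (unconditional in the witness; p480736). -/
theorem stub_speed_floor_at_one_false_of_cappedStageAtOne (hW : CappedStageAtOne) : ¬ SpeedFloorAt 1 :=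
  not_speedFloorAt_one_of_cappedStageAtOne hW

/-- `stub_speed_floor_at_one` dies on ONE registered capped signed swirl-free `τ₁`-slice, number `0.35356`. -/
theorem stub_speed_floor_at_one_false_of_signedNoSwirlSlice {S : Schedule TowerRates.wide}
    (hP : S.Pins 8 (6 / 5)) (hR : S.Rigid) (hQ : S.Quiet)
    (s : Stage 1 TowerRates.wide S (Margins.routeG TowerRates.wide) 1) {M : ℝ}
    (hsl : SignedNoSwirlSlice (s.u (S.τ 1)) M)
    (hlt : 0.35356 * Real.sqrt (Real.sqrt ((∫ y, angVortQuot (s.u (S.τ 1)) y) *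
        ∫ y, cylRadius y ^ 2 * angVortQuot (s.u (S.τ 1)) y) * M) < S.c₁ * TowerRates.wide.Y 2) :
    ¬ SpeedFloorAt 1 :=
  not_speedFloorAt_one_of_signedNoSwirlSlice_eighth hP hR hQ s hsl hlt

/-- Stub 3 dies on every stratum host, by name (p499378). [cite: GallaySverak2016, Prop. 2.6 (2.14)] -/
theorem stub_speed_floor_at_one_false_of_inCapStratum {S : Schedule TowerRates.wide}
    (hP : S.Pins 8 (6 / 5)) (hR : S.Rigid) (hQ : S.Quiet)
    (s : Stage 1 TowerRates.wide S (Margins.routeG TowerRates.wide) 1) (h : InCapStratum 1 S s) :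
    ¬ SpeedFloorAt 1 :=
  not_speedFloorAt_one_of_inCapStratum hP hR hQ s h

/-! Stubs 4–5 (`stub_strain_floor_at_one`, `stub_core_floor_at_one`): cap-blind (the cap bounds speed, not gradient or
circulation; a circulation bound `M·ρ·π/N₂²` from the `η`-max-principle needs Stokes for general `C¹` loops — not in
tree). The retired `stub_apriori_ceiling_at_one` is cap-IMMUNE likewise (`ceiling_of_signedNoSwirlSlice`, p480736).
Whole table: `HeredityAtOneCapSterile.v4_exposure_of_inCapStratum_one`. -/

/-! ## (e) Near-misses — none sorried in v7 -/

/-- **v6's near-miss, DISCHARGED** (fc-prover-3 g6, p484570/p485399): a pinned rigid quiet wide design and ONE smooth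
divergence-free `H^∞` single-signed swirl-free slice carrying its level-1 letter inside the level-1 envelope with
Gallay–Šverák cap value `< c₁ Y₂` — the lazy design `Schedule.ofBox 0 0 1 0 …` and the lazy slice
`hillField 3.92e8 (1/216) (1/210)` (floor `2800`, strain `1.4e6`, loop radius `1/446`, envelope `2963`, cap `5702`).
[cite: Palasek2026ElementaryModel, §4] -/
theorem capped_letter_slice :
    ∃ (S : Schedule TowerRates.wide) (v : EuclideanSpace ℝ (Fin 3) → EuclideanSpace ℝ (Fin 3)) (M : ℝ),
      S.Pins 8 (6 / 5) ∧ S.Rigid ∧ S.Quiet ∧ S.c₁ ≤ S.c₂ ∧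
      (Letter S 1 v ∧ ∀ x, ‖v x‖ ≤ S.c₂ * TowerRates.wide.Y 1) ∧
      ContDiff ℝ ∞ v ∧ VectorCalculus.IsDivFree v ∧ (∀ n : ℕ, ∫⁻ x, ‖iteratedFDeriv ℝ n v x‖ₑ ^ 2 < ⊤) ∧
      SignedNoSwirlSlice v M ∧
      0.35356 * Real.sqrt (Real.sqrt ((∫ y, angVortQuot v y) *
        ∫ y, cylRadius y ^ 2 * angVortQuot v y) * M) < S.c₁ * TowerRates.wide.Y 2 :=
  HeredityAtOneLazySlice.exists_capped_signed_envelope_slice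

/-- **S⁺ (history dropped) is FALSE, outright** (= `StrategyCensus.not_sliceHeredityAtOne`, by body).
[cite: Palasek2026ElementaryModel, §4] -/
theorem heredityAtOneWithoutHistory_false : ¬ HeredityAtOneWithoutHistory :=
  heredityAtOne_false_without_history_of_capped_slice capped_letter_slice

/-- The same through fc-prover-3's direct run (the two negative lines agree). [cite: Palasek2026ElementaryModel, §4] -/
theorem heredityAtOneWithoutHistory_false' : ¬ HeredityAtOneWithoutHistory :=
  HeredityAtOneLazySlice.not_sliceHeredityAtOne_body

/-- The lazy slice is NOT integrable (impulse-carrying, p492172) — consistent with (L3): a capped signed swirl-free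
slice that is registered must carry impulse. [cite: Saffman1992, §3.2 eqs. (3.2.7)–(3.2.8)] -/
theorem lazySlice_carries_impulse : ¬ Integrable HeredityAtOneLazySlice.lazySlice :=
  not_integrable_lazySlice

/-! ## (f) The silent signed sub-register: push ledger, silent window, energy door (g4–g5; all unconditional) -/

/-- **(L3') The stratum is empty on designs of non-positive total axial push** (sibling seat,
`CapStratumImpulseBalance`; the slice impulse is the delivered push). [cite: Saffman1992, §3.2 eq. (3.2.9)]
[cite: Palasek2026ElementaryModel, §4] -/
theorem stratum_empty_on_nonposMean (k : ℕ) :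
    ∀ S : Schedule TowerRates.wide, S.Pins 8 (6 / 5) → S.Rigid → S.Quiet →
      ∀ s : Stage 1 TowerRates.wide S (Margins.routeG TowerRates.wide) k,
        ∫ t in (0 : ℝ)..S.τ k, ∫ x, S.f t x 2 ≤ 0 → ¬ InCapStratum k S s :=
  capStratumEmptyAt_on_nonposMean k

/-- **(L6) `HeredityAtOne` forbids silent capped signed swirl-free hosts at level 1** (g4, p505438): under the item,
a silent pinned rigid design's registered level-1 stage with single-signed swirl-free host has host cap value
`≥ c₁Y₂`. [cite: GallaySverak2016, Prop. 2.6 (2.14)] [cite: Palasek2026ElementaryModel, §4] -/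
theorem no_silent_capped_host_stage (h : Theses.PalasekTowerBreakdown.HeredityAtOne)
    {S : Schedule TowerRates.wide} (hSil : ∀ t, S.τ 0 ≤ t → S.f t = 0) (hP : S.Pins 8 (6 / 5))
    (hR : S.Rigid) (s : Stage 1 TowerRates.wide S (Margins.routeG TowerRates.wide) 1) {M : ℝ}
    (hsl : SignedNoSwirlSlice (s.u (S.τ 0)) M) :
    S.c₁ * TowerRates.wide.Y 2 ≤ 0.35356 * Real.sqrt (Real.sqrt ((∫ y, angVortQuot (s.u (S.τ 0)) y) *
        ∫ y, cylRadius y ^ 2 * angVortQuot (s.u (S.τ 0)) y) * M) :=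
  no_silent_capped_host_stage_of_heredityAtOne h hSil hP hR s hsl

/-- **(L7) The energy–impulse–speed inequality** (g5, p515895): `E(u) ≤ ¼ · U · ∫ (x × curl u)₃` for `C¹`
divergence-free swirl-free `L²` fields bounded by `U` with signed integrable axial impulse density.
[cite: Saffman1992, §3.2 eq. (3.2.11)] -/
theorem energy_impulse_speed_inequality {u : EuclideanSpace ℝ (Fin 3) → EuclideanSpace ℝ (Fin 3)}
    (hu : ContDiff ℝ 1 u) (hdiv : VectorCalculus.IsDivFree u) (hns : HasNoSwirl u)
    (hL2 : Integrable (fun x => ‖u x‖ ^ 2)) {U : ℝ} (hU : ∀ x, ‖u x‖ ≤ U)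
    (hsign : ∀ x, 0 ≤ swirl (curl u) x) (hint : Integrable (fun x => swirl (curl u) x)) :
    VectorCalculus.kineticEnergy u ≤ U / 4 * ∫ x, swirl (curl u) x :=
  kineticEnergy_le_quarter_speed_mul_integral_swirl_curl hu hdiv hns hL2 hU hsign hint

/-- **(L7) The energy door of the silent signed sub-register, wide rates** (g5, p516683): `8 E(s.u τ_j) ≤ V ∫r²η(s.u τ_j)`
at every registered readout `1 ≤ j ≤ k` for every speed bound `V` of the slice — Hill / `hillField` slices
(`ε = 1/7 > ⅛`) are excluded. [cite: Leray1934, §32] [cite: GallaySverak2016, Lemma 6.4]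
[cite: Palasek2026ElementaryModel, §4] -/
theorem silent_signed_energy_door {k : ℕ} {S : Schedule TowerRates.wide} (hSil : ∀ t, S.τ 0 ≤ t → S.f t = 0)
    (s : Stage 1 TowerRates.wide S (Margins.routeG TowerRates.wide) k) {M : ℝ}
    (hsl : SignedNoSwirlSlice (s.u (S.τ 0)) M) {j : ℕ} (h1j : 1 ≤ j) (hj : j ≤ k) {V : ℝ}
    (hV : ∀ x, ‖s.u (S.τ j) x‖ ≤ V) :
    8 * VectorCalculus.kineticEnergy (s.u (S.τ j)) ≤ V * ∫ y, cylRadius y ^ 2 * angVortQuot (s.u (S.τ j)) y :=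
  eight_mul_kineticEnergy_le_of_silent_signed_host hSil s hsl h1j hj hV

/-- **(L6)+(L7) Both static doors of the silent signed sub-register at a level `k ≥ 1`** (g5, p516683): speed cap
from the host (`e > 0.160` needed) AND energy cap at the top readout (`ε ≤ ⅛`). Their conjunction is numerically
INHABITED ((L8): peaked balls, smoothed Hill) — the static levers are spent; emptiness needs dynamics.
[cite: GallaySverak2016, Prop. 2.6 (2.14), Lemma 6.4] [cite: Leray1934, §32] [cite: Palasek2026ElementaryModel, §4] -/
theorem silent_signed_both_doors {k : ℕ} {S : Schedule TowerRates.wide} (hSil : ∀ t, S.τ 0 ≤ t → S.f t = 0)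
    (hk : 1 ≤ k) (s : Stage 1 TowerRates.wide S (Margins.routeG TowerRates.wide) k) {M : ℝ}
    (hsl : SignedNoSwirlSlice (s.u (S.τ 0)) M) {V : ℝ} (hV : ∀ x, ‖s.u (S.τ k) x‖ ≤ V) :
    S.c₁ * TowerRates.wide.Y k ≤ 0.35356 * Real.sqrt (Real.sqrt ((∫ y, angVortQuot (s.u (S.τ 0)) y) *
        ∫ y, cylRadius y ^ 2 * angVortQuot (s.u (S.τ 0)) y) * M) ∧
      8 * VectorCalculus.kineticEnergy (s.u (S.τ k)) ≤
        V * ∫ y, cylRadius y ^ 2 * angVortQuot (s.u (S.τ k)) y :=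
  speed_and_energy_doors_of_silent_signed_host hSil hk s hsl hV

/-! ## (g) The combined door of the silent signed sub-register (g6, p523556; impulse-free; any rates) -/

/-- **(L9) The COMBINED door, any rates** (g6, p523556): on a silent design with globally anchored margins and
single-signed swirl-free host, a registered level-`k` stage whose `τ_k`-slice is single-signed swirl-free of height `M'`
with cap value `< c₁Y_{k+1}` has `4 · 0.35356⁴ · E(s.u τ_k) · ∫η(s.u τ_k) · M'² < c₁⁵ · Y₀ · Y_{k+1}⁴` — the energy door
(L7) times the fourth power of the cap door; the impulse cancels. [cite: GallaySverak2016, Prop. 2.6 (2.14), Lemma 6.4]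
[cite: Leray1934, §32] [cite: Palasek2026ElementaryModel, §4] -/
theorem silent_signed_combined_door {R : TowerRates} {k : ℕ} {S : Schedule R}
    (hSil : ∀ t, S.τ 0 ≤ t → S.f t = 0) (s : Stage 1 R S (Margins.routeG R) k) {M : ℝ}
    (hsl : SignedNoSwirlSlice (s.u (S.τ 0)) M) {M' : ℝ} (hsl' : SignedNoSwirlSlice (s.u (S.τ k)) M')
    (hlt : 0.35356 * Real.sqrt (Real.sqrt ((∫ y, angVortQuot (s.u (S.τ k)) y) *
        ∫ y, cylRadius y ^ 2 * angVortQuot (s.u (S.τ k)) y) * M') < S.c₁ * R.Y (k + 1)) :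
    4 * 0.35356 ^ 4 * VectorCalculus.kineticEnergy (s.u (S.τ k)) * (∫ y, angVortQuot (s.u (S.τ k)) y) * M' ^ 2 <
      S.c₁ ^ 5 * R.Y 0 * R.Y (k + 1) ^ 4 :=
  combined_door_of_silent_signed_slice hSil s hsl hsl' hlt

/-- **(L9) The combined door at a floor point, any rates** (g6, p523556): in the same setting, at every `x` with
`c₁Y_k ≤ ‖s.u τ_k x‖` (one exists in the tower's ball, `Stage.floor`),
`4 · 0.35356⁴ · Y_k⁵ · (E · ∫η · M'²) < Y₀ · Y_{k+1}⁴ · ‖s.u τ_k x‖⁵`: the halo-invariant slice number `F = E·∫η·M'²/sup‖u‖⁵`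
is below `Φ_k = Y₀Y_{k+1}⁴/(4·0.35356⁴·Y_k⁵)` (`185.6, 115.3, 68.33, 38.42, 20.40` for `k = 1 … 5`, wide rates; Hill `81.2`).
[cite: GallaySverak2016, Prop. 2.6 (2.14), Lemma 6.4] [cite: Leray1934, §32] [cite: Palasek2026ElementaryModel, §4] -/
theorem silent_signed_combined_door_floor {R : TowerRates} {k : ℕ} {S : Schedule R}
    (hSil : ∀ t, S.τ 0 ≤ t → S.f t = 0) (s : Stage 1 R S (Margins.routeG R) k) {M : ℝ}
    (hsl : SignedNoSwirlSlice (s.u (S.τ 0)) M) {M' : ℝ} (hsl' : SignedNoSwirlSlice (s.u (S.τ k)) M')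
    (hlt : 0.35356 * Real.sqrt (Real.sqrt ((∫ y, angVortQuot (s.u (S.τ k)) y) *
        ∫ y, cylRadius y ^ 2 * angVortQuot (s.u (S.τ k)) y) * M') < S.c₁ * R.Y (k + 1))
    {x : EuclideanSpace ℝ (Fin 3)} (hx : S.c₁ * R.Y k ≤ ‖s.u (S.τ k) x‖) :
    4 * 0.35356 ^ 4 * R.Y k ^ 5 *
        (VectorCalculus.kineticEnergy (s.u (S.τ k)) * (∫ y, angVortQuot (s.u (S.τ k)) y) * M' ^ 2) <
      R.Y 0 * R.Y (k + 1) ^ 4 * ‖s.u (S.τ k) x‖ ^ 5 :=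
  combined_door_floor_form hSil s hsl hsl' hlt hx

/-- **(L9) The combined door on the census stratum `𝒮_k` (wide rates, `c₁ = 1`)** (g6, p523556): a member of
`InCapStratum k` on a silent signed design has a slice height `M'` with `4 · 0.35356⁴ · E · ∫η · M'² < Y₀ · Y_{k+1}⁴` and the
floor form at every floor point — (L6) × (L7) with the impulse cancelled; the level table of (L9) is its reading.
[cite: GallaySverak2016, Prop. 2.6 (2.14), Lemma 6.4] [cite: Leray1934, §32] [cite: Palasek2026ElementaryModel, §4] -/
theorem stratum_combined_door {k : ℕ} {S : Schedule TowerRates.wide} (hSil : ∀ t, S.τ 0 ≤ t → S.f t = 0)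
    (s : Stage 1 TowerRates.wide S (Margins.routeG TowerRates.wide) k) {M : ℝ}
    (hsl : SignedNoSwirlSlice (s.u (S.τ 0)) M) (h : InCapStratum k S s) :
    ∃ M' : ℝ, SignedNoSwirlSlice (s.u (S.τ k)) M' ∧
      4 * 0.35356 ^ 4 * VectorCalculus.kineticEnergy (s.u (S.τ k)) * (∫ y, angVortQuot (s.u (S.τ k)) y) * M' ^ 2 <
        TowerRates.wide.Y 0 * TowerRates.wide.Y (k + 1) ^ 4 ∧
      ∀ x, TowerRates.wide.Y k ≤ ‖s.u (S.τ k) x‖ →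
        4 * 0.35356 ^ 4 * TowerRates.wide.Y k ^ 5 *
            (VectorCalculus.kineticEnergy (s.u (S.τ k)) * (∫ y, angVortQuot (s.u (S.τ k)) y) * M' ^ 2) <
          TowerRates.wide.Y 0 * TowerRates.wide.Y (k + 1) ^ 4 * ‖s.u (S.τ k) x‖ ^ 5 :=
  combined_door_of_inCapStratum_silent hSil s hsl h

end Summit.NavierStokesRegularity.NavierStokesRegularity.Cruxes.HeredityAtOne.Disproof

end
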